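import Literature.MathematicalPhysics.QuantumLattice.WightmanPermutedTubeConnected
import Literature.MathematicalPhysics.QuantumLattice.ComplexLorentzNormalForms
import HarnessLib

/-!
# The symmetric continuation: the slices of the permuted extended tube are connected (4D)

Topic `Literature/MathematicalPhysics/QuantumLattice` (trunk T-AQFT), sequel of
`WightmanPermutedTubeConnected.lean` and `ComplexLorentzNormalForms.lean`, in the decomposition of
the named fact (K) `IsWightmanQFT.extendedTube_continuation_perm_eq` (`WightmanPermutedTube`;
Osterwalder–Schrader I §5 p. 97 citing Jost p. 83: the Bargmann–Hall–Wightman continuation `𝔚` of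
the `n`-point function of one scalar field satisfies `𝔚(z ∘ σ) = 𝔚(z)` when `z, z ∘ σ ∈ 𝒯'ₙ`). By
`WightmanPermutedTubeConnected`, in four space-time dimensions (K₄) follows from the
preconnectedness of the slices `permSlice 3 n σ = {w ∈ 𝒯ʳₙ | w ∘ σ ∈ 𝒯'ₙ}` (the global step that
OS I refer to Jost and that Tomozawa (1963) proves). This file **proves that preconnectedness**
from the two classical group-theoretic facts recorded in `ComplexLorentzNormalForms` — (N) the
normal forms `Λ = R₁ M R₂`, `M ∈ {S(μ), N(1), −N(1)}`, of proper complex Lorentz transformations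
(Streater–Wightman (2-87)–(2-88)) and (C) the path-connectedness of `L↑₊` (Streater–Wightman
§1-2) — and assembles **(N) + (C) ⇒ (K₄)**
(`IsWightmanQFT.extendedTube_continuation_perm_eq_dim4_of_normalForm`).

The argument (a version of Tomozawa's, organised around the relative tube rather than `L₊(ℂ)`):

* `imPart_sub_mem_forwardCone_of_lt`: in `𝒯ʳₙ` every difference `w_j − w_i`, `i < j`, lies in the
  one-vector tube `𝒯₁ = {Im ∈ V₊}`; `Equiv.Perm.exists_ascent` / `exists_descent`: a permutation
  other than `rev` (resp. `1`) has an ascent (resp. a descent); `permSlice_one`,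
  `permSlice_revPerm`: for `σ = 1` and `σ = rev` the slice is the convex tube `𝒯ʳₙ` (`−1 ∈ L₊(ℂ)`
  in four dimensions);
* `permFiber n M σ = {v ∈ 𝒯ʳₙ | M⁻¹(v ∘ σ) ∈ 𝒯ʳₙ}`: the convex **fibres** of the slice
  (`convex_permFiber`, `permFiber_subset_permSlice`); a point `w` of the slice with
  `w ∘ σ = Λ w'`, `Λ = R₁ M R₂` (N), is joined inside the slice to `R₁⁻¹ w`
  (`joinedIn_permSlice_lorentzActC`, using (C): `𝒯ʳₙ` is `L↑₊`-invariant), which lies in the fibre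
  over `M` (`mem_permFiber_of_eq`);
* the ascent and the descent of `σ` give `u ∈ 𝒯₁`, `u' ∈ −𝒯₁` with `M⁻¹u, M⁻¹u' ∈ 𝒯₁`; by the
  light-cone obstructions of `ComplexLorentzNormalForms` this excludes `M = ±N(1)` and forces
  `M = S(μ)` with `Im μ ≠ 0` (`im_ne_zero_of_screwLin_mem`);
* `sliceConfig n σ μ` (the complex counterpart of the common real points
  `x_k = (0, k, σ⁻¹(k), 0)` of Streater–Wightman Fig. 2-4): points with light-cone coordinates
  `a = P_{μ⁻¹}(k)`, `b = P_μ(k)`, `p = q = 0`, where `Im P_ν(k) = k` and `Im(ν P_ν(k)) = σ⁻¹(k)`; it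
  lies in the fibre over `S(μ)` **for every `σ`** (`sliceConfig_mem_permFiber`) and depends
  continuously on `μ ∈ {Im μ ≠ 0}`; so inside the slice `R₁⁻¹w` is joined to `sliceConfig n σ μ`
  (segment in the convex fibre), which is joined to the configuration of `+i` or `−i`
  (`joinedIn_permSlice_sliceConfig`, parameter segment in the half-plane), and the rotation by
  `π` in the `x²x³`-plane (a path in the slice, `joinedIn_permSlice_rot_pi`) carries the fibre
  over `S(−i)` to the fibre over `S(i) = S((−i)⁻¹)` (`rot_pi_mem_permFiber_screw`);
* hence every point of the slice is joined to `sliceConfig n σ i`: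
  `isPreconnected_permSlice_of_normalForm`; with `permReachable_of_isPreconnected_permSlice` and
  the common real points (`exists_real_mem_relExtendedTube_perm`), `permReachable_dim4_of_normalForm`
  and `IsWightmanQFT.extendedTube_continuation_perm_eq_dim4_of_normalForm`.

In `1 + 1` dimensions the same computation exhibits the failure recorded in
`WightmanPermutedTubeConnected`: there the screws are all of `L₊(ℂ) = ℂˣ`, no rotation identifies
`S(μ)` with `S(μ⁻¹)`, and the slice of `σ = (0 1)`, `n = 3`, has the two components `Im μ ≷ 0`.

## Sources

* Y. Tomozawa, *Local commutativity and the analytic continuation of the Wightman function*,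
  J. Math. Phys. 4 (1963) 1240–1252 (connectedness of the intersections of permuted extended
  tubes; text not held, the proof here is independent). [Tomozawa1963]
* R. F. Streater, A. S. Wightman, *PCT, Spin and Statistics, and All That*: §1-2 (1-9); §2-4,
  proof of the Lemma to Thm. 2-11, (2-87)–(2-90), pdf pp. 61–63; Fig. 2-4, pdf pp. 66–67.
  [StreaterWightman1964]
* K. Osterwalder, R. Schrader, Comm. Math. Phys. 31 (1973), §5 p. 97. [OsterwalderSchraderCMP1973]

## Mathlib / tree

Used: `StrictMono.range_inj`, `StrictAnti.range_inj`, `Fin.strictMono_iff_lt_succ`,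
`Fin.strictAnti_iff_succ_lt`, `Convex.linear_preimage`, `Convex.isPathConnected`,
`IsPathConnected.joinedIn`, `JoinedIn.mono/.trans`, `ContinuousOn.comp_continuous`,
`ContinuousLinearMap.apply`; from the tree `permSlice`, `permReachable_of_isPreconnected_permSlice`
(`WightmanPermutedTubeConnected`), `screw`, `nullRot`, `rot`, the light-cone coordinates and
obstructions, `properComplexLorentz_normalForm`, `restrictedLorentzGroup_isPathConnected`
(`ComplexLorentzNormalForms`), `lorentzActC_mem_relForwardTube` (`WightmanBHWTransport`),
`lorentz_mem_relExtendedTube`, `complexifyLorentz_eq_lorentzActC`,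
`complexifyLorentz_mem_properComplexLorentzGroup_of_restricted`, `convex_relForwardTube`
(`WightmanAnalyticContinuation`), `add_mem_forwardCone` (`JostPoints`),
`exists_real_mem_relExtendedTube_perm` (`WightmanPermutedTubeLocal`),
`IsWightmanQFT.extendedTube_continuation_perm_eq_of_permReachable` (`WightmanPermutedTubeReach`).

## Design choices

* No topology on `L₊(ℂ)` is used: all paths are paths of configurations, produced by explicit
  families (parameter segments, rotations) or transported from (C) through the continuous
  evaluation `f ↦ f x` on `SpaceTime 3 →L[ℝ] SpaceTime 3` (`realActC`).
* The base point of each slice is the slice configuration of `μ = i`; the case `Im μ < 0` is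
  routed through `−i` and the rotation by `π`, which is why `rot θ` was recorded in
  `ComplexLorentzNormalForms` as an element of `L₊(ℂ)` (its realness is not needed: the slices are
  invariant under every element of `L₊(ℂ)` that preserves `𝒯ʳₙ`).
-/

noncomputable section

namespace Literature.MathematicalPhysics.QuantumLattice

open Complex Set Filter
open _root_.Topology
open ComplexLorentz

variable {d n : ℕ}

/-! ### Differences of points of the relative tube -/

/-- **In the relative tube every difference `w_j − w_i` with `i < j` has imaginary part in `V₊`**
(it is the sum of the successive differences in between; `V₊ + V₊ ⊆ V₊`). [folklore] -/
theorem imPart_sub_mem_forwardCone_of_lt {w : Fin n → Fin (d + 1) → ℂ}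
    (hw : w ∈ QuantumFieldTheory.relForwardTube d n) {i j : Fin n} (hij : i < j) :
    imPart (w j - w i) ∈ forwardCone d := by
  -- induction on the gap `j - i - 1`
  suffices h : ∀ (m : ℕ) (i j : Fin n), (j : ℕ) = i + m + 1 → imPart (w j - w i) ∈ forwardCone d by
    obtain ⟨m, hm⟩ : ∃ m : ℕ, (j : ℕ) = i + m + 1 := ⟨j - i - 1, by have := Fin.lt_def.1 hij; omega⟩
    exact h m i j hm
  intro m
  induction m with
  | zero =>
    intro i j hj
    have hjpos : 0 < (j : ℕ) := by omega
    have key := hw j hjpos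
    cases n with
    | zero => exact i.elim0
    | succ n =>
      obtain ⟨j', rfl⟩ := Fin.exists_succ_eq.2 (Fin.pos_iff_ne_zero.1 hjpos)
      rw [succDiff_succ] at key
      have hi : i = j'.castSucc := Fin.ext (by simp at hj; simp; omega)
      rwa [hi]
  | succ m ih =>
    intro i j hj
    have hjpos : 0 < (j : ℕ) := by omega
    cases n with
    | zero => exact i.elim0
    | succ n =>
      obtain ⟨j', rfl⟩ := Fin.exists_succ_eq.2 (Fin.pos_iff_ne_zero.1 hjpos)
      have h1 : imPart (w j'.castSucc - w i) ∈ forwardCone d :=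
        ih i j'.castSucc (by simp at hj ⊢; omega)
      have h2 : imPart (w j'.succ - w j'.castSucc) ∈ forwardCone d := by
        have key := hw j'.succ (by simp)
        rwa [succDiff_succ] at key
      have : w j'.succ - w i = (w j'.succ - w j'.castSucc) + (w j'.castSucc - w i) := by abel
      rw [this, imPart_add]
      exact add_mem_forwardCone h2 h1


/-! ### Ascents and descents of a permutation -/

/-- **A permutation of `Fin n` without a descent is the identity** (it is strictly monotone and
onto). [folklore] -/
theorem Equiv.Perm.eq_one_of_forall_apply_lt {σ : Equiv.Perm (Fin n)}
    (h : ∀ i j : Fin n, (i : ℕ) + 1 = j → σ i < σ j) : σ = 1 := by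
  cases n with
  | zero => exact Subsingleton.elim _ _
  | succ n =>
    have hmono : StrictMono σ := Fin.strictMono_iff_lt_succ.2 fun i => h _ _ (by simp)
    have hrange : Set.range σ = Set.range (id : Fin (n + 1) → Fin (n + 1)) := by
      rw [σ.surjective.range_eq, Set.range_id]
    have hfun : (σ : Fin (n + 1) → Fin (n + 1)) = id := (hmono.range_inj strictMono_id).1 hrange
    exact Equiv.ext fun i => congr_fun hfun i

/-- **A permutation of `Fin n` without an ascent is the order reversal.** [folklore] -/
theorem Equiv.Perm.eq_revPerm_of_forall_lt_apply {σ : Equiv.Perm (Fin n)}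
    (h : ∀ i j : Fin n, (i : ℕ) + 1 = j → σ j < σ i) : σ = Fin.revPerm := by
  cases n with
  | zero => exact Subsingleton.elim _ _
  | succ n =>
    have hanti : StrictAnti σ := Fin.strictAnti_iff_succ_lt.2 fun i => h _ _ (by simp)
    have hrange : Set.range σ = Set.range (Fin.rev : Fin (n + 1) → Fin (n + 1)) := by
      rw [σ.surjective.range_eq, Fin.rev_surjective.range_eq]
    have hfun : (σ : Fin (n + 1) → Fin (n + 1)) = Fin.rev :=
      (hanti.range_inj Fin.rev_strictAnti).1 hrange
    exact Equiv.ext fun i => by rw [Fin.revPerm_apply]; exact congr_fun hfun i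

/-- A permutation other than the identity has a **descent** `σ(i+1) < σ(i)`. [folklore] -/
theorem Equiv.Perm.exists_descent {σ : Equiv.Perm (Fin n)} (hσ : σ ≠ 1) :
    ∃ i j : Fin n, (i : ℕ) + 1 = j ∧ σ j < σ i := by
  by_contra hc
  push Not at hc
  refine hσ (Equiv.Perm.eq_one_of_forall_apply_lt fun i j hij => ?_)
  have hne : σ i ≠ σ j := fun he => by
    have := Fin.val_eq_of_eq (σ.injective he); omega
  exact lt_of_le_of_ne (hc i j hij) hne

/-- A permutation other than the order reversal has an **ascent** `σ(i) < σ(i+1)`. [folklore] -/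
theorem Equiv.Perm.exists_ascent {σ : Equiv.Perm (Fin n)} (hσ : σ ≠ Fin.revPerm) :
    ∃ i j : Fin n, (i : ℕ) + 1 = j ∧ σ i < σ j := by
  by_contra hc
  push Not at hc
  refine hσ (Equiv.Perm.eq_revPerm_of_forall_lt_apply fun i j hij => ?_)
  have hne : σ j ≠ σ i := fun he => by
    have := Fin.val_eq_of_eq (σ.injective he); omega
  exact lt_of_le_of_ne (hc i j hij) hne

/-! ### The slices for the identity and the order reversal -/

/-- The slice of the identity permutation is the whole relative tube. [folklore] -/
theorem permSlice_one : permSlice d n 1 = QuantumFieldTheory.relForwardTube d n := by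
  ext w
  simp only [mem_permSlice_iff, Equiv.Perm.coe_one, id_eq]
  exact ⟨fun h => h.1, fun h => ⟨h, relForwardTube_subset_relExtendedTube h⟩⟩

/-- **In four dimensions the reversed configuration of a point of the relative tube lies in the
extended tube**: `w ∘ rev = (−1) · (−w ∘ rev)`, `−w ∘ rev ∈ 𝒯ʳₙ` and `−1 ∈ L₊(ℂ)`. [folklore] -/
theorem rev_mem_relExtendedTube_of_mem {w : Fin n → Fin (3 + 1) → ℂ}
    (hw : w ∈ QuantumFieldTheory.relForwardTube 3 n) :
    (fun k => w (Fin.revPerm k)) ∈ relExtendedTube 3 n := by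
  refine ⟨LinearEquiv.neg ℂ, neg_mem_properComplexLorentzGroup, fun k => -w (Fin.rev k), ?_, ?_⟩
  · intro k hk
    cases n with
    | zero => exact k.elim0
    | succ n =>
      obtain ⟨m, rfl⟩ := Fin.exists_succ_eq.2 (Fin.pos_iff_ne_zero.1 hk)
      rw [succDiff_succ, show -w (Fin.rev m.succ) - -w (Fin.rev m.castSucc) =
        w (Fin.rev m.castSucc) - w (Fin.rev m.succ) by abel]
      exact imPart_sub_mem_forwardCone_of_lt hw (Fin.rev_lt_rev.2 (Fin.castSucc_lt_succ (i := m)))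
  · funext k
    simp [LinearEquiv.coe_neg]

/-- The slice of the order reversal is the whole relative tube (four dimensions). [folklore] -/
theorem permSlice_revPerm : permSlice 3 n Fin.revPerm = QuantumFieldTheory.relForwardTube 3 n := by
  ext w
  rw [mem_permSlice_iff]
  exact ⟨fun h => h.1, fun h => ⟨h, rev_mem_relExtendedTube_of_mem h⟩⟩

/-! ### Convex fibres of the slices -/

variable (n) in
/-- The **fibre** of the slice over a complex Lorentz transformation `M`:
`{v ∈ 𝒯ʳₙ | M⁻¹ (v ∘ σ) ∈ 𝒯ʳₙ}`, a convex subset of `permSlice 3 n σ` (for `M ∈ L₊(ℂ)`); the slice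
is the union of its fibres. [folklore] -/
def permFiber (M : (Fin 4 → ℂ) ≃ₗ[ℂ] (Fin 4 → ℂ)) (σ : Equiv.Perm (Fin n)) :
    Set (Fin n → Fin (3 + 1) → ℂ) :=
  {v | v ∈ QuantumFieldTheory.relForwardTube 3 n ∧
    (fun k => M.symm (v (σ k))) ∈ QuantumFieldTheory.relForwardTube 3 n}

/-- Membership in a fibre. [folklore] -/
theorem mem_permFiber_iff (M : (Fin 4 → ℂ) ≃ₗ[ℂ] (Fin 4 → ℂ)) (σ : Equiv.Perm (Fin n))
    (v : Fin n → Fin (3 + 1) → ℂ) :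
    v ∈ permFiber n M σ ↔ v ∈ QuantumFieldTheory.relForwardTube 3 n ∧
      (fun k => M.symm (v (σ k))) ∈ QuantumFieldTheory.relForwardTube 3 n := Iff.rfl

/-- **Fibres are convex** (intersection of the convex tube with a linear preimage of it).
[folklore] -/
theorem convex_permFiber (M : (Fin 4 → ℂ) ≃ₗ[ℂ] (Fin 4 → ℂ)) (σ : Equiv.Perm (Fin n)) :
    Convex ℝ (permFiber n M σ) := by
  have h := (convex_relForwardTube (d := 3) (n := n)).linear_preimage
    ((((diagAct 3 n M.symm).comp (permConfig 3 n σ)) :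
      (Fin n → Fin (3 + 1) → ℂ) →ₗ[ℂ] (Fin n → Fin (3 + 1) → ℂ)).restrictScalars ℝ)
  exact (convex_relForwardTube (d := 3) (n := n)).inter h

/-- **Fibres over `L₊(ℂ)` lie in the slice**: `v ∘ σ = M (M⁻¹ (v ∘ σ)) ∈ M 𝒯ʳₙ ⊆ 𝒯'ₙ`. [folklore] -/
theorem permFiber_subset_permSlice {M : (Fin 4 → ℂ) ≃ₗ[ℂ] (Fin 4 → ℂ)}
    (hM : M ∈ properComplexLorentzGroup 3) (σ : Equiv.Perm (Fin n)) :
    permFiber n M σ ⊆ permSlice 3 n σ := fun v hv =>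
  ⟨hv.1, M, hM, _, hv.2, funext fun k => by simp⟩

/-- Every point of the slice lies in the fibre over the transformation exhibiting `w ∘ σ ∈ 𝒯'ₙ`.
[folklore] -/
theorem mem_permFiber_of_eq {w w' : Fin n → Fin (3 + 1) → ℂ} {σ : Equiv.Perm (Fin n)}
    (hw : w ∈ QuantumFieldTheory.relForwardTube 3 n) (hw' : w' ∈ QuantumFieldTheory.relForwardTube 3 n)
    {M : (Fin 4 → ℂ) ≃ₗ[ℂ] (Fin 4 → ℂ)} (heq : (fun k => w (σ k)) = fun k => M (w' k)) :
    w ∈ permFiber n M σ := by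
  refine ⟨hw, ?_⟩
  convert hw' using 1
  funext k
  have hk : w (σ k) = M (w' k) := congr_fun heq k
  simp [hk]


/-! ### Vectors with vanishing `p, q` and their tube membership -/

namespace ComplexLorentz

/-- `Im a = Im z⁰ + Im z³`. [folklore] -/
theorem im_aCoord (z : Fin 4 → ℂ) : (aCoord z).im = (z 0).im + (z 3).im := by
  simp [aCoord]

/-- `Im b = Im z⁰ − Im z³`. [folklore] -/
theorem im_bCoord (z : Fin 4 → ℂ) : (bCoord z).im = (z 0).im - (z 3).im := by
  simp [bCoord]

/-- `a, b, p, q` are additive. [folklore] -/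
theorem aCoord_sub (z w : Fin 4 → ℂ) : aCoord (z - w) = aCoord z - aCoord w := by
  simp [aCoord]; ring
/-- `b` is additive. [folklore] -/
theorem bCoord_sub (z w : Fin 4 → ℂ) : bCoord (z - w) = bCoord z - bCoord w := by
  simp [bCoord]; ring
/-- `p` is additive. [folklore] -/
theorem pCoord_sub (z w : Fin 4 → ℂ) : pCoord (z - w) = pCoord z - pCoord w := by
  simp [pCoord]; ring
/-- `q` is additive. [folklore] -/
theorem qCoord_sub (z w : Fin 4 → ℂ) : qCoord (z - w) = qCoord z - qCoord w := by
  simp [qCoord]; ring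

/-- **A vector with `p = q = 0` and `Im a, Im b > 0` has imaginary part in `V₊`**
(`Im z⁰ = (Im a + Im b)/2 > |Im z³| = |Im a − Im b|/2`, `z¹ = z² = 0`). [folklore] -/
theorem imPart_mem_forwardCone_of_lc {v : Fin 4 → ℂ} (ha : 0 < (aCoord v).im)
    (hb : 0 < (bCoord v).im) (hp : pCoord v = 0) (hq : qCoord v = 0) :
    imPart v ∈ forwardCone 3 := by
  have h1 : v 1 = 0 := by
    simp only [pCoord, qCoord] at hp hq
    linear_combination (hp + hq) / 2
  have h2 : v 2 = 0 := by
    simp only [pCoord, qCoord] at hp hq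
    have h : (2 * I) * v 2 = 0 := by linear_combination hq - hp
    exact (mul_eq_zero.1 h).resolve_left (mul_ne_zero two_ne_zero I_ne_zero)
  rw [im_aCoord] at ha
  rw [im_bCoord] at hb
  rw [mem_forwardCone_iff, minkowskiForm_apply, Fin.sum_univ_three]
  simp only [imPart_apply, Fin.succ_zero_eq_one, Fin.succ_one_eq_two,
    show (2 : Fin 3).succ = (3 : Fin 4) from rfl, h1, h2, Complex.zero_im, mul_zero, zero_add]
  constructor
  · linarith
  · nlinarith

/-! ### The slice configurations (the common points of all fibres over screws) -/

variable {n : ℕ}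

/-- The real part making `x + i m` have `Im(ν (x + i m)) = σ⁻¹(m)`:
`x = (σ⁻¹(m) − Re ν · m) / Im ν`. [folklore] -/
def sliceRe (σ : Equiv.Perm (Fin n)) (ν : ℂ) (m : Fin n) : ℝ :=
  (((σ.symm m : ℕ) : ℝ) - ν.re * (m : ℕ)) / ν.im

/-- The complex number `P_ν(m) = sliceRe σ ν m + i m`: `Im P_ν(m) = m` and, for `Im ν ≠ 0`,
`Im(ν P_ν(m)) = σ⁻¹(m)` — "height `m` in the frame of `𝒯₁`, height `σ⁻¹(m)` in the frame of
`ν⁻¹𝒯₁`". [folklore] -/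
def lcPoint (σ : Equiv.Perm (Fin n)) (ν : ℂ) (m : Fin n) : ℂ :=
  (sliceRe σ ν m : ℂ) + ((m : ℕ) : ℂ) * I

/-- `Im P_ν(m) = m`. [folklore] -/
@[simp] theorem lcPoint_im (σ : Equiv.Perm (Fin n)) (ν : ℂ) (m : Fin n) :
    (lcPoint σ ν m).im = (m : ℕ) := by
  simp [lcPoint]

/-- `Im(ν P_ν(m)) = σ⁻¹(m)` for `Im ν ≠ 0`. [folklore] -/
theorem mul_lcPoint_im (σ : Equiv.Perm (Fin n)) {ν : ℂ} (hν : ν.im ≠ 0) (m : Fin n) :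
    (ν * lcPoint σ ν m).im = (σ.symm m : ℕ) := by
  simp only [lcPoint, sliceRe, Complex.mul_im, Complex.add_re, Complex.ofReal_re, Complex.mul_re,
    Complex.natCast_re, Complex.I_re, mul_zero, Complex.natCast_im, Complex.I_im, mul_one, sub_zero,
    add_zero, Complex.add_im, Complex.ofReal_im, Complex.mul_im, zero_add]
  field_simp
  ring

variable (n) in
/-- **The slice configuration** attached to a permutation `σ` and a screw parameter `μ` with
`Im μ ≠ 0`: the points with light-cone coordinates `a = P_{μ⁻¹}(m)`, `b = P_μ(m)`, `p = q = 0`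
(`x¹ = x² = 0`). Its successive differences and those of `S(μ)⁻¹ (· ∘ σ)` all have imaginary part
`(1, 0, 0, 0) ∈ V₊`, so it lies in the fibre of the slice of `σ` over `S(μ)`, for every `σ`
(the complex counterpart of the common real points `x_k = (0, k, σ⁻¹(k), 0)` of
`exists_real_mem_relExtendedTube_perm`). [folklore] -/
def sliceConfig (σ : Equiv.Perm (Fin n)) (μ : ℂ) : Fin n → Fin (3 + 1) → ℂ := fun m =>
  ![(lcPoint σ μ⁻¹ m + lcPoint σ μ m) / 2, 0, 0, (lcPoint σ μ⁻¹ m - lcPoint σ μ m) / 2]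

/-- Light-cone coordinates of the slice configuration: `a = P_{μ⁻¹}`. [folklore] -/
@[simp] theorem aCoord_sliceConfig (σ : Equiv.Perm (Fin n)) (μ : ℂ) (m : Fin n) :
    aCoord (sliceConfig n σ μ m) = lcPoint σ μ⁻¹ m := by
  simp [aCoord, sliceConfig]; ring
/-- Light-cone coordinates of the slice configuration: `b = P_μ`. [folklore] -/
@[simp] theorem bCoord_sliceConfig (σ : Equiv.Perm (Fin n)) (μ : ℂ) (m : Fin n) :
    bCoord (sliceConfig n σ μ m) = lcPoint σ μ m := by
  simp [bCoord, sliceConfig]; ring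
/-- Light-cone coordinates of the slice configuration: `p = 0`. [folklore] -/
@[simp] theorem pCoord_sliceConfig (σ : Equiv.Perm (Fin n)) (μ : ℂ) (m : Fin n) :
    pCoord (sliceConfig n σ μ m) = 0 := by
  simp [pCoord, sliceConfig]
/-- Light-cone coordinates of the slice configuration: `q = 0`. [folklore] -/
@[simp] theorem qCoord_sliceConfig (σ : Equiv.Perm (Fin n)) (μ : ℂ) (m : Fin n) :
    qCoord (sliceConfig n σ μ m) = 0 := by
  simp [qCoord, sliceConfig]

/-- `Im μ ≠ 0 ⇒ μ ≠ 0`. [folklore] -/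
theorem ne_zero_of_im_ne_zero {μ : ℂ} (hμ : μ.im ≠ 0) : μ ≠ 0 := by
  rintro rfl; simp at hμ

/-- `Im μ ≠ 0 ⇒ Im μ⁻¹ ≠ 0`. [folklore] -/
theorem inv_im_ne_zero {μ : ℂ} (hμ : μ.im ≠ 0) : (μ⁻¹).im ≠ 0 := by
  rw [Complex.inv_im, div_ne_zero_iff]
  exact ⟨neg_ne_zero.2 hμ, (Complex.normSq_pos.2 (ne_zero_of_im_ne_zero hμ)).ne'⟩

/-- **The slice configuration lies in the relative tube.** [folklore] -/
theorem sliceConfig_mem_relForwardTube (σ : Equiv.Perm (Fin n)) (μ : ℂ) :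
    sliceConfig n σ μ ∈ QuantumFieldTheory.relForwardTube 3 n := by
  intro k hk
  cases n with
  | zero => exact k.elim0
  | succ n =>
    obtain ⟨m, rfl⟩ := Fin.exists_succ_eq.2 (Fin.pos_iff_ne_zero.1 hk)
    rw [succDiff_succ]
    refine imPart_mem_forwardCone_of_lc ?_ ?_ ?_ ?_
    · rw [aCoord_sub, Complex.sub_im, aCoord_sliceConfig, aCoord_sliceConfig, lcPoint_im, lcPoint_im]
      simp
    · rw [bCoord_sub, Complex.sub_im, bCoord_sliceConfig, bCoord_sliceConfig, lcPoint_im, lcPoint_im]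
      simp
    · rw [pCoord_sub, pCoord_sliceConfig, pCoord_sliceConfig, sub_zero]
    · rw [qCoord_sub, qCoord_sliceConfig, qCoord_sliceConfig, sub_zero]

/-- **The screw `S(μ)⁻¹` carries the permuted slice configuration into the relative tube.**
[folklore] -/
theorem screw_symm_sliceConfig_mem_relForwardTube (σ : Equiv.Perm (Fin n)) {μ : ℂ} (hμ : μ.im ≠ 0) :
    (fun k => (screw μ (ne_zero_of_im_ne_zero hμ)).symm (sliceConfig n σ μ (σ k))) ∈
      QuantumFieldTheory.relForwardTube 3 n := by
  intro k hk
  cases n with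
  | zero => exact k.elim0
  | succ n =>
    obtain ⟨m, rfl⟩ := Fin.exists_succ_eq.2 (Fin.pos_iff_ne_zero.1 hk)
    rw [succDiff_succ]
    simp only [screw_symm_apply, ← map_sub]
    refine imPart_mem_forwardCone_of_lc ?_ ?_ ?_ ?_
    · rw [aCoord_screwLin, aCoord_sub, mul_sub, Complex.sub_im, aCoord_sliceConfig, aCoord_sliceConfig,
        mul_lcPoint_im σ (inv_im_ne_zero hμ), mul_lcPoint_im σ (inv_im_ne_zero hμ)]
      simp
    · rw [bCoord_screwLin, bCoord_sub, mul_sub, Complex.sub_im, bCoord_sliceConfig, bCoord_sliceConfig,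
        mul_lcPoint_im σ hμ, mul_lcPoint_im σ hμ]
      simp
    · rw [pCoord_screwLin, pCoord_sub, pCoord_sliceConfig, pCoord_sliceConfig, sub_zero, mul_zero]
    · rw [qCoord_screwLin, qCoord_sub, qCoord_sliceConfig, qCoord_sliceConfig, sub_zero, mul_zero]

/-- **The slice configuration of `σ` and `μ` lies in the fibre of the slice of `σ` over `S(μ)`.**
[folklore] -/
theorem sliceConfig_mem_permFiber (σ : Equiv.Perm (Fin n)) {μ : ℂ} (hμ : μ.im ≠ 0) :
    sliceConfig n σ μ ∈ permFiber n (screw μ (ne_zero_of_im_ne_zero hμ)) σ :=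
  ⟨sliceConfig_mem_relForwardTube σ μ, screw_symm_sliceConfig_mem_relForwardTube σ hμ⟩

/-- Continuity of `ν ↦ P_ν(m)` where `Im ν ≠ 0`. [folklore] -/
theorem continuousOn_lcPoint (σ : Equiv.Perm (Fin n)) (m : Fin n) :
    ContinuousOn (fun ν : ℂ => lcPoint σ ν m) {ν | ν.im ≠ 0} := by
  have h : ContinuousOn (fun ν : ℂ => sliceRe σ ν m) {ν | ν.im ≠ 0} := by
    refine ContinuousOn.div ?_ Complex.continuous_im.continuousOn fun ν hν => hν
    exact (continuous_const.sub (Complex.continuous_re.mul continuous_const)).continuousOn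
  exact (Complex.continuous_ofReal.comp_continuousOn h).add continuousOn_const

/-- Continuity of `μ ↦ P_{μ⁻¹}(m)` where `Im μ ≠ 0`. [folklore] -/
theorem continuousOn_lcPoint_inv (σ : Equiv.Perm (Fin n)) (m : Fin n) :
    ContinuousOn (fun μ : ℂ => lcPoint σ μ⁻¹ m) {μ | μ.im ≠ 0} := by
  refine (continuousOn_lcPoint σ m).comp (continuousOn_inv₀.mono ?_) ?_
  · exact fun μ hμ => ne_zero_of_im_ne_zero hμ
  · exact fun μ hμ => inv_im_ne_zero hμ

/-- **The slice configuration depends continuously on `μ` in `{Im μ ≠ 0}`.** [folklore] -/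
theorem continuousOn_sliceConfig (σ : Equiv.Perm (Fin n)) :
    ContinuousOn (fun μ : ℂ => sliceConfig n σ μ) {μ | μ.im ≠ 0} := by
  refine continuousOn_pi.2 fun m => continuousOn_pi.2 fun i => ?_
  fin_cases i
  · simpa [sliceConfig] using ((continuousOn_lcPoint_inv σ m).add (continuousOn_lcPoint σ m)).div_const 2
  · simpa [sliceConfig] using continuousOn_const
  · simpa [sliceConfig] using continuousOn_const
  · simpa [sliceConfig] using ((continuousOn_lcPoint_inv σ m).sub (continuousOn_lcPoint σ m)).div_const 2


/-! ### Real rotations act on the slices -/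

/-- **Rotations preserve the forward cone**: `Im(rot θ v) = rot θ (Im v)` has the same time
component and the same spatial norm. [folklore] -/
theorem imPart_rot_mem_forwardCone (θ : ℝ) {v : Fin 4 → ℂ} (hv : imPart v ∈ forwardCone 3) :
    imPart (rot θ v) ∈ forwardCone 3 := by
  rw [mem_forwardCone_iff, minkowskiForm_apply, Fin.sum_univ_three] at hv ⊢
  simp only [imPart_apply, Fin.succ_zero_eq_one, Fin.succ_one_eq_two,
    show (2 : Fin 3).succ = (3 : Fin 4) from rfl, rot_apply, rotLin_apply_zero, rotLin_apply_one,
    rotLin_apply_two, rotLin_apply_three, Complex.sub_im, Complex.add_im, Complex.mul_im,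
    Complex.ofReal_re, Complex.ofReal_im, zero_mul, add_zero] at hv ⊢
  obtain ⟨h0, hq⟩ := hv
  refine ⟨h0, ?_⟩
  have hcs := Real.cos_sq_add_sin_sq θ
  have key : (v 0).im * (v 0).im -
      ((v 1).im * (v 1).im +
        (Real.cos θ * (v 2).im - Real.sin θ * (v 3).im) * (Real.cos θ * (v 2).im - Real.sin θ * (v 3).im) +
        (Real.sin θ * (v 2).im + Real.cos θ * (v 3).im) * (Real.sin θ * (v 2).im + Real.cos θ * (v 3).im)) =
      (v 0).im * (v 0).im - ((v 1).im * (v 1).im + (v 2).im * (v 2).im + (v 3).im * (v 3).im) := by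
    linear_combination (-((v 2).im ^ 2) - (v 3).im ^ 2) * hcs
  rw [key]
  exact hq

/-- Rotating every point of a configuration of the relative tube keeps it there. [folklore] -/
theorem rot_mem_relForwardTube (θ : ℝ) {v : Fin n → Fin (3 + 1) → ℂ}
    (hv : v ∈ QuantumFieldTheory.relForwardTube 3 n) :
    (fun k => rot θ (v k)) ∈ QuantumFieldTheory.relForwardTube 3 n := by
  intro k hk
  rw [succDiff_map (rot θ) (fun a b => map_sub (rot θ) a b) v k]
  exact imPart_rot_mem_forwardCone θ (hv k hk)

/-- **The slices are invariant under the real rotations** (`𝒯ʳₙ` is, and `rot θ ∈ L₊(ℂ)` commutes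
with permutations of the points). [folklore] -/
theorem rot_mem_permSlice (θ : ℝ) {σ : Equiv.Perm (Fin n)} {v : Fin n → Fin (3 + 1) → ℂ}
    (hv : v ∈ permSlice 3 n σ) : (fun k => rot θ (v k)) ∈ permSlice 3 n σ :=
  ⟨rot_mem_relForwardTube θ hv.1, lorentz_mem_relExtendedTube hv.2 (rot_mem_properComplexLorentzGroup θ)⟩

/-- Continuity of `θ ↦ (rot θ v_k)_k`. [folklore] -/
theorem continuous_rot_config (v : Fin n → Fin (3 + 1) → ℂ) :
    Continuous fun θ : ℝ => fun k => rot θ (v k) := by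
  refine continuous_pi fun k => continuous_pi fun i => ?_
  have hc : Continuous fun θ : ℝ => (Real.cos θ : ℂ) := Complex.continuous_ofReal.comp Real.continuous_cos
  have hs : Continuous fun θ : ℝ => (Real.sin θ : ℂ) := Complex.continuous_ofReal.comp Real.continuous_sin
  fin_cases i
  · exact continuous_const
  · exact continuous_const
  · exact (hc.mul continuous_const).sub (hs.mul continuous_const)
  · exact (hs.mul continuous_const).add (hc.mul continuous_const)

/-- `rot 0 = 1`. [folklore] -/
theorem rot_zero_apply (z : Fin 4 → ℂ) : rot 0 z = z := by
  rw [rot_apply, Real.cos_zero, Real.sin_zero]; push_cast; rw [rotLin_one_zero]; rfl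

/-- **A point of the slice is joined inside the slice to its rotation by `π`** (along
`θ ↦ rot θ`, `0 ≤ θ ≤ π`). [folklore] -/
theorem joinedIn_permSlice_rot_pi {σ : Equiv.Perm (Fin n)} {v : Fin n → Fin (3 + 1) → ℂ}
    (hv : v ∈ permSlice 3 n σ) : JoinedIn (permSlice 3 n σ) v (fun k => rot Real.pi (v k)) := by
  refine ⟨{ toFun := fun t => fun k => rot (Real.pi * t) (v k),
             continuous_toFun :=
               (continuous_rot_config v).comp (continuous_const.mul continuous_subtype_val),
             source' := ?_,
             target' := ?_ }, fun t => rot_mem_permSlice _ hv⟩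
  · funext k; simp only [Set.Icc.coe_zero, mul_zero]; exact rot_zero_apply (v k)
  · funext k; simp only [Set.Icc.coe_one, mul_one]

/-- `rot π` is an involution. [folklore] -/
theorem rotLin_neg_one_rotLin_neg_one (z : Fin 4 → ℂ) : rotLin (-1) 0 (rotLin (-1) 0 z) = z := by
  rw [← LinearMap.comp_apply, rotLin_comp]
  norm_num
  rw [rotLin_one_zero]; rfl

/-- **The rotation by `π` maps the fibre over `S(μ)` to the fibre over `S(μ⁻¹)`**
(`rot(π) S(μ) rot(π) = S(μ⁻¹)`). [folklore] -/
theorem rot_pi_mem_permFiber_screw {σ : Equiv.Perm (Fin n)} {μ : ℂ} (hμ : μ ≠ 0)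
    {v : Fin n → Fin (3 + 1) → ℂ} (hv : v ∈ permFiber n (screw μ hμ) σ) :
    (fun k => rot Real.pi (v k)) ∈ permFiber n (screw μ⁻¹ (inv_ne_zero hμ)) σ := by
  refine ⟨rot_mem_relForwardTube _ hv.1, ?_⟩
  have key : ∀ x : Fin 4 → ℂ, (screw μ⁻¹ (inv_ne_zero hμ)).symm (rot Real.pi x) =
      rot Real.pi ((screw μ hμ).symm x) := fun x => by
    rw [screw_symm_apply, screw_symm_apply, inv_inv, rot_pi_apply, rot_pi_apply,
      ← rotLin_screwLin_rotLin μ⁻¹ μ (rotLin (-1) 0 x), rotLin_neg_one_rotLin_neg_one]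
  simp only [key]
  exact rot_mem_relForwardTube _ hv.2

/-! ### Moving inside a slice by real Lorentz transformations (uses (C)) -/

/-- The complexified action of a real continuous linear map of space-time (for `f = Λ` a Lorentz
transformation this is `lorentzActC Λ`). [folklore] -/
def realActC (f : SpaceTime d →L[ℝ] SpaceTime d) (z : Fin (d + 1) → ℂ) : Fin (d + 1) → ℂ :=
  complexifyPoint (f (rePart z)) + (I : ℂ) • complexifyPoint (f (imPart z))

/-- `realActC ↑Λ = lorentzActC Λ`. [folklore] -/
theorem realActC_coe (Λ : SpaceTime d ≃L[ℝ] SpaceTime d) (z : Fin (d + 1) → ℂ) :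
    realActC (Λ : SpaceTime d →L[ℝ] SpaceTime d) z = lorentzActC Λ z := rfl

/-- `f ↦ realActC f z` is continuous (topology of matrix elements). [folklore] -/
theorem continuous_realActC (z : Fin (d + 1) → ℂ) :
    Continuous fun f : SpaceTime d →L[ℝ] SpaceTime d => realActC f z := by
  unfold realActC
  refine ((continuous_complexifyPoint.comp ?_).add
    ((continuous_complexifyPoint.comp ?_).const_smul (I : ℂ)))
  · exact (ContinuousLinearMap.apply ℝ (SpaceTime d) (rePart z)).continuous
  · exact (ContinuousLinearMap.apply ℝ (SpaceTime d) (imPart z)).continuous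

/-- **Inside a slice one can move by any restricted Lorentz transformation** (four dimensions,
given the path-connectedness (C) of `L↑₊`): a path `Λ_t` in `L↑₊` from `1` to `Λ` gives the path
`Λ_t w` in the slice (`𝒯ʳₙ` is `L↑₊`-invariant and `(Λ_t w) ∘ σ = Λ_t (w ∘ σ) ∈ 𝒯'ₙ`). [folklore] -/
theorem joinedIn_permSlice_lorentzActC (hC : restrictedLorentzGroup_isPathConnected)
    {σ : Equiv.Perm (Fin n)} {w : Fin n → Fin (3 + 1) → ℂ} (hw : w ∈ permSlice 3 n σ)
    {Λ : SpaceTime 3 ≃L[ℝ] SpaceTime 3} (hΛ : Λ ∈ restrictedLorentzGroup 3) :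
    JoinedIn (permSlice 3 n σ) w (fun k => lorentzActC Λ (w k)) := by
  have h1 : ((1 : SpaceTime 3 ≃L[ℝ] SpaceTime 3) : SpaceTime 3 →L[ℝ] SpaceTime 3) ∈
      (fun R : SpaceTime 3 ≃L[ℝ] SpaceTime 3 => (R : SpaceTime 3 →L[ℝ] SpaceTime 3)) ''
        (restrictedLorentzGroup 3 : Set (SpaceTime 3 ≃L[ℝ] SpaceTime 3)) :=
    ⟨1, Subgroup.one_mem _, rfl⟩
  have hΛ' : (Λ : SpaceTime 3 →L[ℝ] SpaceTime 3) ∈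
      (fun R : SpaceTime 3 ≃L[ℝ] SpaceTime 3 => (R : SpaceTime 3 →L[ℝ] SpaceTime 3)) ''
        (restrictedLorentzGroup 3 : Set (SpaceTime 3 ≃L[ℝ] SpaceTime 3)) := ⟨Λ, hΛ, rfl⟩
  obtain ⟨γ, hγ⟩ := hC.joinedIn _ h1 _ hΛ'
  refine ⟨{ toFun := fun t => fun k => realActC (γ t) (w k),
             continuous_toFun :=
               continuous_pi fun k => (continuous_realActC (w k)).comp γ.continuous,
             source' := ?_,
             target' := ?_ }, fun t => ?_⟩
  · funext k
    simp only [Path.source]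
    rw [realActC_coe, QuantumFieldTheory.lorentzActC_one]
  · funext k
    simp only [Path.target]
    rfl
  · obtain ⟨R, hR, hRt⟩ := hγ t
    have hfun : (fun k => realActC (γ t) (w k)) = fun k => lorentzActC R (w k) := by
      funext k; rw [← hRt]; rfl
    show (fun k => realActC (γ t) (w k)) ∈ permSlice 3 n σ
    rw [hfun]
    refine ⟨lorentzActC_mem_relForwardTube ⟨R, hR⟩ hw.1, ?_⟩
    have h := lorentz_mem_relExtendedTube hw.2 (complexifyLorentz_mem_properComplexLorentzGroup_of_restricted hR)
    simpa only [complexifyLorentz_eq_lorentzActC] using h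


/-! ### Paths of slice configurations -/

/-- `screw` does not depend on the proof of `μ ≠ 0` and respects equalities of the parameter.
[folklore] -/
theorem screw_congr {μ ν : ℂ} (h : μ = ν) (hμ : μ ≠ 0) (hν : ν ≠ 0) : screw μ hμ = screw ν hν := by
  subst h; rfl

/-- **Slice configurations with screw parameters in the same half-plane are joined inside the
slice** (along the segment of parameters, which stays in the half-plane). [folklore] -/
theorem joinedIn_permSlice_sliceConfig (σ : Equiv.Perm (Fin n)) {μ ν : ℂ} (h : 0 < μ.im * ν.im) :
    JoinedIn (permSlice 3 n σ) (sliceConfig n σ μ) (sliceConfig n σ ν) := by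
  have hμ : μ.im ≠ 0 := fun h0 => by rw [h0, zero_mul] at h; exact lt_irrefl 0 h
  -- the parameter path and its imaginary part
  have him : ∀ t : unitInterval, (μ + (t : ℝ) * (ν - μ)).im ≠ 0 := by
    intro t
    have ht0 : 0 ≤ (t : ℝ) := t.2.1
    have ht1 : (t : ℝ) ≤ 1 := t.2.2
    have hform : (μ + (t : ℝ) * (ν - μ)).im = (1 - (t : ℝ)) * μ.im + (t : ℝ) * ν.im := by
      simp [Complex.add_im, Complex.mul_im, Complex.sub_im]; ring
    rw [hform]
    intro h0
    have key : 0 < ((1 - (t : ℝ)) * μ.im + (t : ℝ) * ν.im) * μ.im := by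
      rcases eq_or_lt_of_le ht1 with heq | hlt
      · rw [heq]; nlinarith
      · have h2 : 0 < (1 - (t : ℝ)) * (μ.im * μ.im) := mul_pos (by linarith) (mul_self_pos.2 hμ)
        nlinarith
    rw [h0, zero_mul] at key
    exact lt_irrefl 0 key
  refine ⟨{ toFun := fun t => sliceConfig n σ (μ + (t : ℝ) * (ν - μ)),
             continuous_toFun := (continuousOn_sliceConfig σ).comp_continuous
               (continuous_const.add ((Complex.continuous_ofReal.comp continuous_subtype_val).mul
                 continuous_const)) him,
             source' := by simp,
             target' := by simp }, fun t => ?_⟩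
  exact permFiber_subset_permSlice (screw_mem_properComplexLorentzGroup _ _) σ
    (sliceConfig_mem_permFiber σ (him t))

/-! ### The slices are preconnected (four dimensions, from (N) and (C)) -/

/-- **Every slice `{w ∈ 𝒯ʳₙ | w ∘ σ ∈ 𝒯'ₙ}` is preconnected in four space-time dimensions**, given
the normal forms (N) of `L₊(ℂ)` and the path-connectedness (C) of `L↑₊`. For `σ = 1` and
`σ = rev` the slice is the convex tube `𝒯ʳₙ`. Otherwise `σ` has an ascent and a descent; a point
`w` of the slice, `w ∘ σ = Λ w'`, `Λ = R₁ M R₂`, is joined inside the slice to `R₁⁻¹ w` (C), which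
lies in the convex fibre over `M`; the ascent and the descent provide vectors `u ∈ 𝒯₁`, `u' ∈ −𝒯₁`
with `M⁻¹u, M⁻¹u' ∈ 𝒯₁`, which excludes `M = ±N(1)` and forces `M = S(μ)` with `Im μ ≠ 0`; the
fibre over `S(μ)` contains the slice configuration of `μ`, which is joined to that of `+i` or
`−i` along the parameter half-plane, and the rotation by `π` joins the configuration of `−i` to
the fibre over `S(i)`. Hence every point is joined to the slice configuration of `i`. [folklore] -/
theorem isPreconnected_permSlice_of_normalForm (hN : properComplexLorentz_normalForm)
    (hC : restrictedLorentzGroup_isPathConnected) (σ : Equiv.Perm (Fin n)) :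
    IsPreconnected (permSlice 3 n σ) := by
  by_cases h1 : σ = 1
  · subst h1
    rw [permSlice_one]
    exact (convex_relForwardTube (d := 3) (n := n)).isPreconnected
  by_cases hr : σ = Fin.revPerm
  · subst hr
    rw [permSlice_revPerm]
    exact (convex_relForwardTube (d := 3) (n := n)).isPreconnected
  obtain ⟨i₁, j₁, hij₁, hasc⟩ := Equiv.Perm.exists_ascent hr
  obtain ⟨i₂, j₂, hij₂, hdesc⟩ := Equiv.Perm.exists_descent h1
  have hlt₁ : i₁ < j₁ := Fin.lt_def.2 (by omega)
  have hlt₂ : i₂ < j₂ := Fin.lt_def.2 (by omega)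
  have hIim : (I : ℂ).im ≠ 0 := by simp
  set S := permSlice 3 n σ with hS
  set base : Fin n → Fin (3 + 1) → ℂ := sliceConfig n σ I with hbase
  have hbaseF : base ∈ permFiber n (screw I I_ne_zero) σ := sliceConfig_mem_permFiber σ hIim
  have hbaseS : base ∈ S := permFiber_subset_permSlice (screw_mem_properComplexLorentzGroup _ _) σ hbaseF
  suffices key : ∀ w ∈ S, JoinedIn S w base by
    have hpc : IsPathConnected S := ⟨base, hbaseS, fun {w} hw => (key w hw).symm⟩
    exact hpc.isConnected.isPreconnected
  intro w hw
  have hw0 := hw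
  obtain ⟨hwT, Λ, hΛ, w', hw', heq⟩ := hw0
  obtain ⟨R₁, hR₁, R₂, hR₂, M, hM, hΛeq⟩ := hN Λ hΛ
  -- Step 1: move to `w₁ = R₁⁻¹ w`
  set w₁ : Fin n → Fin (3 + 1) → ℂ := fun k => lorentzActC R₁⁻¹ (w k) with hw₁
  have hj₁ : JoinedIn S w w₁ := joinedIn_permSlice_lorentzActC hC hw ((restrictedLorentzGroup 3).inv_mem hR₁)
  have hw₁T : w₁ ∈ QuantumFieldTheory.relForwardTube 3 n :=
    lorentzActC_mem_relForwardTube ⟨R₁⁻¹, (restrictedLorentzGroup 3).inv_mem hR₁⟩ hwT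
  -- Step 2: `w₁` lies in the fibre over `M`
  have hw₂T : (fun k => lorentzActC R₂ (w' k)) ∈ QuantumFieldTheory.relForwardTube 3 n :=
    lorentzActC_mem_relForwardTube ⟨R₂, hR₂⟩ hw'
  have hcancel : ∀ x : Fin (3 + 1) → ℂ, lorentzActC R₁⁻¹ (lorentzActC R₁ x) = x := fun x => by
    rw [← QuantumFieldTheory.lorentzActC_mul, inv_mul_cancel, QuantumFieldTheory.lorentzActC_one]
  have heq₁ : (fun k => w₁ (σ k)) = fun k => M (lorentzActC R₂ (w' k)) := by
    funext k
    have hk : w (σ k) = Λ (w' k) := congr_fun heq k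
    simp only [hw₁, hk, hΛeq, LinearEquiv.mul_apply, complexifyLorentz_eq_lorentzActC, hcancel]
  have hw₁F : w₁ ∈ permFiber n M σ := mem_permFiber_of_eq hw₁T hw₂T heq₁
  -- Step 3: the vectors supplied by the ascent and the descent
  have hu : imPart (w₁ (σ j₁) - w₁ (σ i₁)) ∈ forwardCone 3 := imPart_sub_mem_forwardCone_of_lt hw₁T hasc
  have hMu : imPart (M.symm (w₁ (σ j₁) - w₁ (σ i₁))) ∈ forwardCone 3 := by
    rw [map_sub]; exact imPart_sub_mem_forwardCone_of_lt hw₁F.2 hlt₁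
  have hu' : imPart (-(w₁ (σ j₂) - w₁ (σ i₂))) ∈ forwardCone 3 := by
    rw [neg_sub]; exact imPart_sub_mem_forwardCone_of_lt hw₁T hdesc
  have hMu' : imPart (M.symm (w₁ (σ j₂) - w₁ (σ i₂))) ∈ forwardCone 3 := by
    rw [map_sub]; exact imPart_sub_mem_forwardCone_of_lt hw₁F.2 hlt₂
  rcases hM with ⟨μ, hμ0, rfl⟩ | rfl | rfl
  · -- `M = S(μ)`: `Im μ ≠ 0`
    have hμim : μ.im ≠ 0 :=
      im_ne_zero_of_screwLin_mem (ν := μ⁻¹) hu (by simpa using hMu) hu' (by simpa using hMu')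
    -- Step 4: segment inside the fibre over `S(μ)` to the slice configuration of `μ`
    have hcfgF : sliceConfig n σ μ ∈ permFiber n (screw μ hμ0) σ := sliceConfig_mem_permFiber σ hμim
    have hj₂ : JoinedIn S w₁ (sliceConfig n σ μ) :=
      (((convex_permFiber _ σ).isPathConnected ⟨w₁, hw₁F⟩).joinedIn _ hw₁F _ hcfgF).mono
        (permFiber_subset_permSlice (screw_mem_properComplexLorentzGroup μ hμ0) σ)
    -- Step 5/6: along the parameter to `±i`, and the rotation by `π` if needed
    rcases lt_or_gt_of_ne hμim with hneg | hpos
    · have hj₃ : JoinedIn S (sliceConfig n σ μ) (sliceConfig n σ (-I)) :=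
        joinedIn_permSlice_sliceConfig σ (by simp; linarith)
      have hnegIim : (-I : ℂ).im ≠ 0 := by simp
      have hcfgS : sliceConfig n σ (-I) ∈ S :=
        permFiber_subset_permSlice (screw_mem_properComplexLorentzGroup _ _) σ
          (sliceConfig_mem_permFiber σ hnegIim)
      have hj₄ : JoinedIn S (sliceConfig n σ (-I)) (fun k => rot Real.pi (sliceConfig n σ (-I) k)) :=
        joinedIn_permSlice_rot_pi hcfgS
      have hrotF : (fun k => rot Real.pi (sliceConfig n σ (-I) k)) ∈ permFiber n (screw I I_ne_zero) σ := by
        have h := rot_pi_mem_permFiber_screw (ne_zero_of_im_ne_zero hnegIim)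
          (sliceConfig_mem_permFiber σ hnegIim)
        rwa [screw_congr (show (-I : ℂ)⁻¹ = I by simp) _ I_ne_zero] at h
      have hj₅ : JoinedIn S (fun k => rot Real.pi (sliceConfig n σ (-I) k)) base :=
        (((convex_permFiber _ σ).isPathConnected ⟨base, hbaseF⟩).joinedIn _ hrotF _ hbaseF).mono
          (permFiber_subset_permSlice (screw_mem_properComplexLorentzGroup I I_ne_zero) σ)
      exact hj₁.trans (hj₂.trans (hj₃.trans (hj₄.trans hj₅)))
    · have hj₃ : JoinedIn S (sliceConfig n σ μ) base :=
        joinedIn_permSlice_sliceConfig σ (by simp; exact hpos)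
      exact hj₁.trans (hj₂.trans hj₃)
  · -- `M = N(1)` is impossible (descent)
    exact (not_neg_mem_and_nullRotLin_mem (-1) hu' (by simpa using hMu')).elim
  · -- `M = −N(1)` is impossible (ascent)
    refine (not_mem_and_neg_nullRotLin_mem (-1) hu ?_).elim
    simpa [LinearEquiv.coe_neg] using hMu

end ComplexLorentz

/-! ### Assembly: (N) + (C) ⇒ reachability ⇒ (K₄) -/

open ComplexLorentz in
/-- **Reachability in four dimensions from the normal forms (N) and the connectedness (C) of
`L↑₊`** (with the common real points of Streater–Wightman Fig. 2-4). [folklore] -/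
theorem permReachable_dim4_of_normalForm (hN : properComplexLorentz_normalForm)
    (hC : restrictedLorentzGroup_isPathConnected) (n : ℕ) : PermReachable 3 n :=
  permReachable_of_isPreconnected_permSlice (fun σ _ => isPreconnected_permSlice_of_normalForm hN hC σ)
    fun σ _ => exists_real_mem_relExtendedTube_perm (m := 1) σ

open ComplexLorentz in
/-- **(N) + (C) ⇒ (K₄).** The consistency of the Bargmann–Hall–Wightman continuation under
permutations in four space-time dimensions (`IsWightmanQFT.extendedTube_continuation_perm_eq_dim4`;
OS I §5 p. 97, Jost p. 83, Tomozawa (1963)) follows from the normal forms of complex Lorentz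
transformations (Streater–Wightman (2-87)–(2-88)) and the connectedness of `L↑₊`
(Streater–Wightman §1-2), everything else — Streater–Wightman Thm. 3-2 (d), Thm. 3-6, Fig. 2-4,
the slices and their fibres — being proved in the tree. [folklore] -/
theorem IsWightmanQFT.extendedTube_continuation_perm_eq_dim4_of_normalForm {κ : Type*}
    (hN : properComplexLorentz_normalForm) (hC : restrictedLorentzGroup_isPathConnected) :
    IsWightmanQFT.extendedTube_continuation_perm_eq_dim4 (κ := κ) :=
  IsWightmanQFT.extendedTube_continuation_perm_eq_of_permReachable (permReachable_dim4_of_normalForm hN hC)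

end Literature.MathematicalPhysics.QuantumLattice
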